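import Summits.NavierStokesRegularity.NavierStokesRegularity.Theses.FlatSwirlGauge
import Literature.Analysis.FluidPDE.HarmonicBallMeanValue
import Literature.Analysis.FluidPDE.LocalBiotSavartCalculus

/-!
# Crux `CriticalSwirlRegularity` (stmt-NavierStokesRegularity-1253): the irrotational sub-case holds,
# by the energy class and the mean value property

Support file for the crux `CriticalSwirlRegularity` (CSR) of route `FlatSwirlGauge` (NavierStokesRegularity),
written by the line lead (continuation c7). It is the positive companion of
`Negative/EnergyClassLoadBearing.lean` (same directory): there the KNSS parasitic drift flow — irrotational,
hence carrying the TRIVIAL flat swirl gauge `α ≡ 0`, `b ≡ 0`, `d ≡ 1` — shows that CSR is FALSE once the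
Leray–Hopf clause is deleted. Here: WITH the Leray–Hopf clause, CSR is TRUE on every cylinder on which the flow
is irrotational (where, again, the gauge hypothesis is automatic), and the proof is exactly "energy class ⇒
pointwise bound through an elliptic mean-value estimate":

* `integral_norm_sq_le_of_isLerayHopfOn` — the energy inequality from `0` with `f = 0`, dissipation dropped:
  `∫ ‖u(t)‖² ≤ ∫ ‖u₀‖²` for every `t ∈ [0, T]` (Leray 1934, (5.2)).
* `curl_eq_zero_of_eventuallyEq_zero`, `laplacian_coord_eq_zero_of_irrotational` — where a smooth
  divergence-free field is irrotational on a neighbourhood, each Cartesian component is harmonic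
  (`Δu = −curl curl u`, in-tree `laplacian_coord_eq_neg_curl_curl`).
* `exists_bound_newtonFarLaplacian`, `abs_le_mul_setIntegral_abs_of_laplacian_eq_zero` — the weighted
  mean value property on a ball (in-tree `eq_integral_newtonFarLaplacian_mul_of_laplacian_eq_zero`,
  Gilbarg–Trudinger Thm 2.1) turned into the sup bound `|h(y)| ≤ M ∫_{B̄(y, r₁)} |h|`.
* `setIntegral_abs_apply_le` — `∫_{B̄} |v_m| ≤ ½ (vol B̄ + ∫ ‖v‖²)` (from `|a| ≤ ½(1 + a²)`).
* `bounded_near_of_irrotational` — **the irrotational sub-case of the crux**: a classical solution on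
  `[0, T)`, Leray–Hopf from `u 0`, irrotational on `Q_ρ(T, x₀)`, is bounded on `Q_{ρ/2}(T, x₀)` by
  `2 M (vol B̄_ρ(x₀) + ∫ ‖u 0‖²)`.
* `criticalSwirlRegularity_irrotational_case` — the same in the crux's own quantifier shape (the gauge
  hypothesis replaced by irrotationality on the cylinder, which implies it with the trivial gauge).
* `trivialFlatGauge_of_irrotational`, `criticalSwirlRegularity_irrotational_case_of_criticalSwirlRegularity` —
  irrotational cylinders carry the trivial gauge (`C₀ = M = 0`, `α ≡ 0`, `b ≡ 0`, `d ≡ ρ + 1`), so the proved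
  sub-case is literally an instance of the crux (which, by name, implies it): the first sub-case of
  `CriticalSwirlRegularity` settled unconditionally.

Reading for planners / ideators (together with the negative companion): in the irrotational class the crux is
EQUIVALENT to the presence of the energy class; the mechanism that converts `u(t) ∈ L²` into a pointwise bound is
an interior elliptic estimate. In the rotational flat class the analogous conversion is ε-regularity
(Caffarelli–Kohn–Nirenberg): a viable line must show that the flat gauge forces SMALLNESS of a CKN quantity at
`(T, x₀)`, not a modulus of the momentum `α` (the dead line `registered`). Nothing here closes the item
(`--supports`); nothing here is new mathematics.

## References

* J. Leray, *Sur le mouvement d'un liquide visqueux emplissant l'espace*, Acta Math. 63 (1934), (5.2). [Leray1934]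
* D. Gilbarg, N. S. Trudinger, *Elliptic partial differential equations of second order* (2001), Thm 2.1
  (mean value property). [GilbargTrudinger2001]
-/

noncomputable section

open MeasureTheory Set Function Filter Metric Topology
open scoped RealInnerProductSpace InnerProductSpace Laplacian ContDiff
open Literature.Analysis.FluidPDE

namespace Summit.NavierStokesRegularity.NavierStokesRegularity.Theorems.CriticalSwirlRegularity.Negative

/-! ### The energy class: `‖u(t)‖₂ ≤ ‖u₀‖₂` -/

/-- **Uniform `L²` bound of an unforced Leray–Hopf solution.** For `IsLerayHopfOn T ν 0 u₀ u` with `ν ≥ 0` and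
every `t ∈ [0, T]`: `∫ ‖u t x‖² dx ≤ ∫ ‖u₀ x‖² dx` — the energy inequality from `0` (field `weakGrad_energy`,
projection `energy_ineq_zero`) with the force term `∫∫⟪0, u⟫ = 0` and the dissipation dropped
(Leray 1934, (5.2)). [cite: Leray1934, (5.2)] -/
theorem integral_norm_sq_le_of_isLerayHopfOn {T ν : ℝ}
    {u₀ : EuclideanSpace ℝ (Fin 3) → EuclideanSpace ℝ (Fin 3)}
    {u : ℝ → EuclideanSpace ℝ (Fin 3) → EuclideanSpace ℝ (Fin 3)}
    (h : IsLerayHopfOn T ν 0 u₀ u) (hν : 0 ≤ ν) {t : ℝ} (ht : t ∈ Icc 0 T) :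
    ∫ x, ‖u t x‖ ^ 2 ≤ ∫ x, ‖u₀ x‖ ^ 2 := by
  obtain ⟨G, -, hE⟩ := h.energy_ineq_zero
  have h1 := hE t ht
  have hf : (∫ τ in (0 : ℝ)..t, ∫ x,
      ⟪(0 : ℝ → EuclideanSpace ℝ (Fin 3) → EuclideanSpace ℝ (Fin 3)) τ x, u τ x⟫) = 0 := by
    simp
  have hD : 0 ≤ ν * (∫⁻ τ in Ioo 0 t, ∫⁻ x, ENNReal.ofReal (frobeniusNormSq (G τ x))).toReal :=
    mul_nonneg hν ENNReal.toReal_nonneg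
  rw [hf, add_zero] at h1
  unfold VectorCalculus.kineticEnergy at h1
  linarith

/-! ### Irrotational and solenoidal ⇒ harmonic components -/

/-- If a field vanishes identically near `w` (as the curl does on an irrotational region), its curl at `w`
vanishes: the Fréchet derivative of a germ of the zero map is zero. [folklore] -/
theorem curl_eq_zero_of_eventuallyEq_zero {V : EuclideanSpace ℝ (Fin 3) → EuclideanSpace ℝ (Fin 3)}
    {w : EuclideanSpace ℝ (Fin 3)} (hV : V =ᶠ[𝓝 w] fun _ => 0) : curl V w = 0 := by
  have hf : fderiv ℝ V w = 0 := by
    rw [hV.fderiv_eq]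
    simp
  ext i
  fin_cases i <;> simp [curl, hf]

/-- **Irrotational + divergence-free ⇒ harmonic components.** If `v ∈ C²(ℝ³; ℝ³)` is divergence free and
`curl v = 0` on an open set `U`, then every Cartesian component `v_m` is harmonic on `U`:
`Δ v_m = −(curl curl v)_m = 0` there (in-tree `laplacian_coord_eq_neg_curl_curl`; Majda–Bertozzi §2.4).
[folklore] -/
theorem laplacian_coord_eq_zero_of_irrotational
    {v : EuclideanSpace ℝ (Fin 3) → EuclideanSpace ℝ (Fin 3)} (hv : ContDiff ℝ 2 v)
    (hdiv : VectorCalculus.IsDivFree v) {U : Set (EuclideanSpace ℝ (Fin 3))} (hU : IsOpen U)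
    (hcurl : ∀ x ∈ U, curl v x = 0) (m : Fin 3) {w : EuclideanSpace ℝ (Fin 3)} (hw : w ∈ U) :
    (Δ (fun z => v z m)) w = 0 := by
  have hev : curl v =ᶠ[𝓝 w] fun _ => 0 := by
    filter_upwards [hU.mem_nhds hw] with x hx
    exact hcurl x hx
  rw [laplacian_coord_eq_neg_curl_curl hv hdiv w m, curl_eq_zero_of_eventuallyEq_zero hev]
  simp

/-! ### Mean value ⇒ sup bound by the `L¹` mass on a ball -/

/-- A uniform bound for the mean-value weight `λ^{r₀,r₁}` (`newtonFarLaplacian`, smooth with compact support).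
[folklore] -/
theorem exists_bound_newtonFarLaplacian {r₀ r₁ : ℝ} (h₀ : 0 < r₀) (h₁ : r₀ < r₁) :
    ∃ M : ℝ, 0 ≤ M ∧ ∀ z : EuclideanSpace ℝ (Fin 3), |newtonFarLaplacian r₀ r₁ z| ≤ M := by
  obtain ⟨M, hM⟩ := (continuous_newtonFarLaplacian h₀ h₁).bounded_above_of_compact_support
    (hasCompactSupport_newtonFarLaplacian h₀.le h₁)
  refine ⟨max M 0, le_max_right _ _, fun z => ?_⟩
  have h := hM z
  rw [Real.norm_eq_abs] at h
  exact h.trans (le_max_left _ _)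

/-- **Sup bound from the mean value property on a ball.** If `h ∈ C²(ℝ³)` is harmonic on the open ball
`B(y, r₁)` and `|λ^{r₀,r₁}| ≤ M`, then `|h(y)| ≤ M ∫_{B̄(y, r₁)} |h|`: write `h(y) = ∫ λ(z) h(y − z) dz`
(in-tree `eq_integral_newtonFarLaplacian_mul_of_laplacian_eq_zero`, Gilbarg–Trudinger Thm 2.1 in weighted
radial form), change variables `w = y − z` and use that `λ` is supported in `|z| ≤ r₁`.
[cite: GilbargTrudinger2001, Thm 2.1] -/
theorem abs_le_mul_setIntegral_abs_of_laplacian_eq_zero {r₀ r₁ : ℝ} (h₀ : 0 < r₀) (h₁ : r₀ < r₁)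
    {h : EuclideanSpace ℝ (Fin 3) → ℝ} (hh : ContDiff ℝ 2 h) {y : EuclideanSpace ℝ (Fin 3)}
    (hΔ : ∀ w ∈ ball y r₁, (Δ h) w = 0) {M : ℝ}
    (hM : ∀ z : EuclideanSpace ℝ (Fin 3), |newtonFarLaplacian r₀ r₁ z| ≤ M) :
    |h y| ≤ M * ∫ w in closedBall y r₁, |h w| := by
  have hmv := eq_integral_newtonFarLaplacian_mul_of_laplacian_eq_zero h₀ h₁ hh hΔ
  -- change variables `w = y - z`
  have hcv : ∫ z, newtonFarLaplacian r₀ r₁ z * h (y - z) =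
      ∫ w, newtonFarLaplacian r₀ r₁ (y - w) * h w := by
    rw [← integral_sub_left_eq_self (fun z => newtonFarLaplacian r₀ r₁ z * h (y - z)) volume y]
    refine integral_congr_ae (Eventually.of_forall fun w => ?_)
    simp only [sub_sub_cancel]
  rw [hmv, hcv]
  -- pointwise domination by the indicator of the closed ball
  have hdom : ∀ w, ‖newtonFarLaplacian r₀ r₁ (y - w) * h w‖ ≤
      (closedBall y r₁).indicator (fun w => M * |h w|) w := by
    intro w
    by_cases hw : w ∈ closedBall y r₁
    · rw [indicator_of_mem hw, norm_mul, Real.norm_eq_abs, Real.norm_eq_abs]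
      exact mul_le_mul_of_nonneg_right (hM _) (abs_nonneg _)
    · rw [indicator_of_notMem hw]
      have hw' : r₁ < ‖y - w‖ := by
        rw [mem_closedBall, dist_eq_norm, not_le, ← norm_neg, neg_sub] at hw
        exact hw
      rw [newtonFarLaplacian_eq_zero_of_gt h₀.le h₁ hw', zero_mul, norm_zero]
  have hhi : IntegrableOn (fun w => |h w|) (closedBall y r₁) :=
    (hh.continuous.abs.continuousOn).integrableOn_compact (isCompact_closedBall y r₁)
  calc |∫ w, newtonFarLaplacian r₀ r₁ (y - w) * h w|
      ≤ ∫ w, ‖newtonFarLaplacian r₀ r₁ (y - w) * h w‖ := by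
        rw [← Real.norm_eq_abs]; exact norm_integral_le_integral_norm _
    _ ≤ ∫ w, (closedBall y r₁).indicator (fun w => M * |h w|) w := by
        refine integral_mono_of_nonneg (Eventually.of_forall fun w => norm_nonneg _) ?_
          (Eventually.of_forall hdom)
        exact IntegrableOn.integrable_indicator
          (show IntegrableOn (fun w => M * |h w|) (closedBall y r₁) volume from hhi.const_mul M)
          measurableSet_closedBall
    _ = M * ∫ w in closedBall y r₁, |h w| := by
        rw [integral_indicator measurableSet_closedBall, integral_const_mul]

/-- **`L¹` mass of a component on a ball by volume plus energy**: for continuous `v : ℝ³ → ℝ³` with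
`‖v‖² ∈ L¹(ℝ³)`, `∫_{B̄(y, r)} |v_m| ≤ ½ (vol B̄(y, r) + ∫ ‖v‖²)` (pointwise `|v_m| ≤ ‖v‖ ≤ ½(1 + ‖v‖²)`).
[folklore] -/
theorem setIntegral_abs_apply_le {v : EuclideanSpace ℝ (Fin 3) → EuclideanSpace ℝ (Fin 3)}
    (hv : Continuous v) (hint : Integrable (fun x => ‖v x‖ ^ 2)) (y : EuclideanSpace ℝ (Fin 3)) (r : ℝ)
    (m : Fin 3) :
    ∫ w in closedBall y r, |v w m| ≤ (volume.real (closedBall y r) + ∫ x, ‖v x‖ ^ 2) / 2 := by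
  have hK : IsCompact (closedBall y r) := isCompact_closedBall y r
  have hcm : Continuous fun w => v w m := (PiLp.continuous_apply 2 _ m).comp hv
  have hi1 : IntegrableOn (fun w => |v w m|) (closedBall y r) :=
    hcm.abs.continuousOn.integrableOn_compact hK
  have hc2 : Continuous fun w => ‖v w‖ ^ 2 := (hv.norm).pow 2
  have hi2 : IntegrableOn (fun w => ‖v w‖ ^ 2) (closedBall y r) := hint.integrableOn
  have hi3 : IntegrableOn (fun _ => (1 : ℝ)) (closedBall y r) :=
    continuousOn_const.integrableOn_compact hK
  have hg : IntegrableOn (fun w => ((1 : ℝ) + ‖v w‖ ^ 2) / 2) (closedBall y r) :=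
    (hi3.add hi2).div_const 2
  have hle : ∀ w, |v w m| ≤ ((1 : ℝ) + ‖v w‖ ^ 2) / 2 := fun w => by
    have h1 : |v w m| ≤ ‖v w‖ := by
      have := PiLp.norm_apply_le (v w) m
      rwa [Real.norm_eq_abs] at this
    nlinarith [sq_nonneg (‖v w‖ - 1)]
  calc ∫ w in closedBall y r, |v w m|
      ≤ ∫ w in closedBall y r, ((1 : ℝ) + ‖v w‖ ^ 2) / 2 := setIntegral_mono hi1 hg hle
    _ = (volume.real (closedBall y r) + ∫ w in closedBall y r, ‖v w‖ ^ 2) / 2 := by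
        rw [integral_div, integral_add hi3 hi2, setIntegral_const, smul_eq_mul, mul_one]
    _ ≤ (volume.real (closedBall y r) + ∫ x, ‖v x‖ ^ 2) / 2 := by
        have hsl : ∫ w in closedBall y r, ‖v w‖ ^ 2 ≤ ∫ x, ‖v x‖ ^ 2 :=
          setIntegral_le_integral hint (Eventually.of_forall fun x => by positivity)
        linarith

/-! ### The irrotational sub-case of the crux -/

/-- **The irrotational sub-case of `CriticalSwirlRegularity` holds.** Let `(u, p)` be a classical solution of
unforced Navier–Stokes on `ℝ³ × [0, T)` (`ν > 0`), Leray–Hopf on `[0, T]` from `u 0`, and suppose `curl u = 0`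
on the backward cylinder `Q_ρ(T, x₀)` (times `t ≥ 0`), `0 < ρ`. Then `u` is bounded on `Q_{ρ/2}(T, x₀)`:
for `t ∈ (T − ρ²/4, T)`, `t ≥ 0`, `y ∈ B_{ρ/2}(x₀)`, each component `u_m(t, ·)` is harmonic on
`B_{ρ/2}(y) ⊆ B_ρ(x₀)` (`Δu = −curl curl u`, `div u = 0`), so by the mean value property
`|u_m(t, y)| ≤ M ∫_{B̄_{ρ/2}(y)} |u_m(t)| ≤ ½ M (vol B̄_ρ(x₀) + ∫‖u(t)‖²) ≤ ½ M (vol B̄_ρ(x₀) + ∫‖u(0)‖²)`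
by the energy inequality. The gauge hypothesis of the crux is automatic here (trivial gauge `α ≡ 0`, `b ≡ 0`,
`d ≡ 1`, cf. `driftVel_trivialFlatGauge`), and WITHOUT the Leray–Hopf clause the conclusion fails in this very
class (`criticalSwirlRegularity_false_without_isLerayHopfOn`). [folklore] -/
theorem bounded_near_of_irrotational {ν T : ℝ} (hν : 0 < ν)
    {u : ℝ → EuclideanSpace ℝ (Fin 3) → EuclideanSpace ℝ (Fin 3)} {p : ℝ → EuclideanSpace ℝ (Fin 3) → ℝ}
    (hcl : IsClassicalNSSolutionOn (Set.Ico 0 T) ν 0 u p) (hLH : IsLerayHopfOn T ν 0 (u 0) u)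
    {x₀ : EuclideanSpace ℝ (Fin 3)} {ρ : ℝ} (hρ : 0 < ρ)
    (hirr : ∀ t ∈ Set.Ioo (T - ρ ^ 2) T, 0 ≤ t → ∀ x ∈ Metric.ball x₀ ρ, curl (u t) x = 0) :
    ∃ r : ℝ, 0 < r ∧ ∃ K : ℝ, ∀ t ∈ Set.Ioo (T - r ^ 2) T, 0 ≤ t →
      ∀ x ∈ Metric.ball x₀ r, ‖u t x‖ ≤ K := by
  -- the mean value weight at scale `ρ/2` and its sup bound
  obtain ⟨M, hM0, hM⟩ := exists_bound_newtonFarLaplacian (r₀ := ρ / 4) (r₁ := ρ / 2)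
    (by positivity) (by linarith)
  set E₀ : ℝ := ∫ x, ‖u 0 x‖ ^ 2 with hE₀
  set V : ℝ := volume.real (closedBall x₀ ρ) with hV
  have hE₀0 : 0 ≤ E₀ := integral_nonneg fun x => by positivity
  have hV0 : 0 ≤ V := measureReal_nonneg
  refine ⟨ρ / 2, by positivity, 2 * (M * ((V + E₀) / 2)), fun t ht ht0 y hy => ?_⟩
  -- times: `t ∈ [0, T)` and `t ∈ (T - ρ², T)`
  have htT : t < T := ht.2
  have htI : t ∈ Set.Ico 0 T := ⟨ht0, htT⟩
  have htIcc : t ∈ Set.Icc 0 T := ⟨ht0, htT.le⟩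
  have ht' : t ∈ Set.Ioo (T - ρ ^ 2) T := ⟨by nlinarith [ht.1], htT⟩
  -- the slice `v = u t`: smooth, divergence free, irrotational on `B_ρ(x₀)`, finite energy
  have hv : ContDiff ℝ 2 (u t) := (hcl.contDiff_velocity htI).of_le (by norm_cast)
  have hdiv : VectorCalculus.IsDivFree (u t) := hcl.divFree t htI
  have hcurl : ∀ x ∈ ball x₀ ρ, curl (u t) x = 0 := hirr t ht' ht0
  have hmem := hLH.memLp t htIcc
  have hint : Integrable (fun x => ‖u t x‖ ^ 2) := (memLp_two_iff_integrable_sq_norm hmem.1).1 hmem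
  have hEt : ∫ x, ‖u t x‖ ^ 2 ≤ E₀ := integral_norm_sq_le_of_isLerayHopfOn hLH hν.le htIcc
  -- the ball `B_{ρ/2}(y)` sits inside `B_ρ(x₀)`
  have hsub : ball y (ρ / 2) ⊆ ball x₀ ρ := by
    refine ball_subset_ball' ?_
    rw [mem_ball] at hy
    linarith
  have hsubc : closedBall y (ρ / 2) ⊆ closedBall x₀ ρ := by
    refine closedBall_subset_closedBall' ?_
    rw [mem_ball] at hy
    linarith
  have hVy : volume.real (closedBall y (ρ / 2)) ≤ V :=
    measureReal_mono hsubc measure_closedBall_lt_top.ne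
  -- each component is bounded by `B = M (V + E₀)/2`
  have hcoord : ∀ m : Fin 3, |u t y m| ≤ M * ((V + E₀) / 2) := by
    intro m
    have hh : ContDiff ℝ 2 (fun z => u t z m) := contDiff_euclidean.1 hv m
    have hΔ : ∀ w ∈ ball y (ρ / 2), (Δ (fun z => u t z m)) w = 0 := fun w hw =>
      laplacian_coord_eq_zero_of_irrotational hv hdiv isOpen_ball hcurl m (hsub hw)
    calc |u t y m| ≤ M * ∫ w in closedBall y (ρ / 2), |u t w m| :=
          abs_le_mul_setIntegral_abs_of_laplacian_eq_zero (by positivity) (by linarith) hh hΔ hM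
      _ ≤ M * ((volume.real (closedBall y (ρ / 2)) + ∫ x, ‖u t x‖ ^ 2) / 2) := by
          gcongr
          exact setIntegral_abs_apply_le hv.continuous hint y (ρ / 2) m
      _ ≤ M * ((V + E₀) / 2) := by gcongr
  -- `‖u t y‖ ≤ 2B` from the three coordinate bounds (`√3 ≤ 2`)
  have hc : ∀ i : Fin 3, ‖u t y i‖ ^ 2 ≤ (M * ((V + E₀) / 2)) ^ 2 := fun i => by
    rw [Real.norm_eq_abs]
    exact pow_le_pow_left₀ (abs_nonneg _) (hcoord i) 2
  rw [EuclideanSpace.norm_eq, Real.sqrt_le_iff]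
  refine ⟨by positivity, ?_⟩
  calc ∑ i, ‖u t y i‖ ^ 2 ≤ ∑ _i : Fin 3, (M * ((V + E₀) / 2)) ^ 2 := Finset.sum_le_sum fun i _ => hc i
    _ = 3 * (M * ((V + E₀) / 2)) ^ 2 := by simp
    _ ≤ (2 * (M * ((V + E₀) / 2))) ^ 2 := by nlinarith [sq_nonneg (M * ((V + E₀) / 2))]

/-- **The irrotational sub-case of the crux, in the crux's quantifier shape.** Same class of solutions as
`CriticalSwirlRegularity` (classical on `[0, T)`, Leray–Hopf from the rapidly decaying datum `u 0`); if `u` is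
irrotational on some backward cylinder `Q_ρ(T, x₀)` (`0 < ρ`, `ρ² < T`) — a hypothesis under which the flat
swirl gauge of the crux exists trivially — then `u` is bounded near `(T, x₀)`. [folklore] -/
theorem criticalSwirlRegularity_irrotational_case :
    ∀ (ν T : ℝ), 0 < ν → 0 < T →
      ∀ (u : ℝ → EuclideanSpace ℝ (Fin 3) → EuclideanSpace ℝ (Fin 3))
        (p : ℝ → EuclideanSpace ℝ (Fin 3) → ℝ),
        IsClassicalNSSolutionOn (Set.Ico 0 T) ν 0 u p → IsLerayHopfOn T ν 0 (u 0) u →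
        HasRapidSpatialDecay (u 0) →
        ∀ x₀ : EuclideanSpace ℝ (Fin 3),
          (∃ ρ : ℝ, 0 < ρ ∧ ρ ^ 2 < T ∧
            ∀ t ∈ Set.Ioo (T - ρ ^ 2) T, ∀ x ∈ Metric.ball x₀ ρ, curl (u t) x = 0) →
          ∃ r : ℝ, 0 < r ∧ ∃ K : ℝ, ∀ t ∈ Set.Ioo (T - r ^ 2) T, 0 ≤ t →
            ∀ x ∈ Metric.ball x₀ r, ‖u t x‖ ≤ K := by
  intro ν T hν _ u p hcl hLH _ x₀ hirr
  obtain ⟨ρ, hρ, -, hcurl⟩ := hirr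
  exact bounded_near_of_irrotational hν hcl hLH hρ fun t ht _ x hx => hcurl t ht x hx

/-! ### The irrotational sub-case sits inside the crux's hypothesis class -/

/-- **Irrotational cylinders carry the trivial flat swirl gauge.** If `curl (u t) = 0` on the backward cylinder
`Q_ρ(T, x₀)` (`0 < ρ`, `ρ² < T`), then the v0 flat-swirl-gauge block of the crux holds there verbatim with
`C₀ = 0`, `M = 0`, `α ≡ 0`, `b ≡ 0`, `d ≡ ρ + 1` (every vorticity clause reads `0 ≤ 0`, the degeneracy sets
`{d < δ}`, `δ < ρ`, are empty, the transport law is `0 = ν · 0`). So the sub-case proved in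
`bounded_near_of_irrotational` is literally an instance of the crux's hypothesis (the route reviews' junk test:
"`α ≡ const` is admissible exactly on irrotational cylinders"). [folklore] -/
theorem trivialFlatGauge_of_irrotational (ν T : ℝ)
    (u : ℝ → EuclideanSpace ℝ (Fin 3) → EuclideanSpace ℝ (Fin 3)) (x₀ : EuclideanSpace ℝ (Fin 3))
    {ρ : ℝ} (hρ : 0 < ρ) (hρT : ρ ^ 2 < T)
    (hirr : ∀ t ∈ Set.Ioo (T - ρ ^ 2) T, ∀ x ∈ Metric.ball x₀ ρ, curl (u t) x = 0) :
    ∃ (ρ C₀ M : ℝ) (α : ℝ → EuclideanSpace ℝ (Fin 3) → ℝ)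
      (b : ℝ → EuclideanSpace ℝ (Fin 3) → EuclideanSpace ℝ (Fin 3)) (d : ℝ → EuclideanSpace ℝ (Fin 3) → ℝ),
      0 < ρ ∧ ρ ^ 2 < T ∧
        ContDiffOn ℝ 2 (Function.uncurry α) (Set.Ioo (T - ρ ^ 2) T ×ˢ Metric.ball x₀ ρ) ∧
        (∀ t ∈ Set.Ioo (T - ρ ^ 2) T, ∀ δ ∈ Set.Ioo 0 ρ,
          MeasureTheory.volume ({x | d t x < δ} ∩ Metric.ball x₀ ρ) ≤ ENNReal.ofReal (C₀ * δ ^ 2 * ρ)) ∧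
        (∀ t ∈ Set.Ioo (T - ρ ^ 2) T, ∀ x ∈ Metric.ball x₀ ρ, |α t x| ≤ M ∧
          inner ℝ (curl (u t) x) (gradient (α t) x) = 0 ∧
          (0 < d t x →
            ‖curl (u t) x‖ * d t x ≤ C₀ * ‖gradient (α t) x‖ ∧ ‖b t x‖ * d t x ≤ C₀ ∧
              deriv (fun s => α s x) t + convect (u t) (α t) x =
                ν * (Laplacian.laplacian (α t) x + inner ℝ (b t x) (gradient (α t) x)))) := by
  refine ⟨ρ, 0, 0, fun _ _ => 0, fun _ _ => 0, fun _ _ => ρ + 1, hρ, hρT, ?_, ?_, ?_⟩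
  · -- `α ≡ 0` is smooth
    exact contDiffOn_const
  · -- the degeneracy sets `{ρ + 1 < δ}`, `δ < ρ`, are empty
    intro t _ δ hδ
    have hempty : {x : EuclideanSpace ℝ (Fin 3) | ρ + 1 < δ} ∩ Metric.ball x₀ ρ = ∅ := by
      ext x
      simp only [Set.mem_inter_iff, Set.mem_setOf_eq, Set.mem_empty_iff_false, iff_false, not_and]
      intro h
      exact absurd h (by linarith [hδ.2])
    rw [hempty, measure_empty]
    exact bot_le
  · intro t ht x hx
    have hcurl : curl (u t) x = 0 := hirr t ht x hx
    have hgrad : gradient (fun _ : EuclideanSpace ℝ (Fin 3) => (0 : ℝ)) x = 0 := gradient_fun_const x 0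
    have hlap : Laplacian.laplacian (fun _ : EuclideanSpace ℝ (Fin 3) => (0 : ℝ)) x = 0 := by
      rw [InnerProductSpace.laplacian_const]; rfl
    refine ⟨by simp, by simp [hgrad], fun _ => ⟨by simp [hcurl], by simp, ?_⟩⟩
    simp [hlap]

/-- **The proved sub-case is an instance of the crux.** `CriticalSwirlRegularity` (by name) implies the
irrotational case `criticalSwirlRegularity_irrotational_case` through the trivial gauge — recorded only to certify
the direction of containment; the sub-case itself is proved unconditionally above. [folklore] -/
theorem criticalSwirlRegularity_irrotational_case_of_criticalSwirlRegularity
    (hCSR : Summit.NavierStokesRegularity.NavierStokesRegularity.Theses.FlatSwirlGauge.CriticalSwirlRegularity)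
    {ν T : ℝ} (hν : 0 < ν) (hT : 0 < T)
    {u : ℝ → EuclideanSpace ℝ (Fin 3) → EuclideanSpace ℝ (Fin 3)} {p : ℝ → EuclideanSpace ℝ (Fin 3) → ℝ}
    (hcl : IsClassicalNSSolutionOn (Set.Ico 0 T) ν 0 u p) (hLH : IsLerayHopfOn T ν 0 (u 0) u)
    (hdec : HasRapidSpatialDecay (u 0)) {x₀ : EuclideanSpace ℝ (Fin 3)} {ρ : ℝ} (hρ : 0 < ρ) (hρT : ρ ^ 2 < T)
    (hirr : ∀ t ∈ Set.Ioo (T - ρ ^ 2) T, ∀ x ∈ Metric.ball x₀ ρ, curl (u t) x = 0) :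
    ∃ r : ℝ, 0 < r ∧ ∃ K : ℝ, ∀ t ∈ Set.Ioo (T - r ^ 2) T, 0 ≤ t →
      ∀ x ∈ Metric.ball x₀ r, ‖u t x‖ ≤ K :=
  hCSR ν T hν hT u p hcl hLH hdec x₀ (trivialFlatGauge_of_irrotational ν T u x₀ hρ hρT hirr)

end Summit.NavierStokesRegularity.NavierStokesRegularity.Theorems.CriticalSwirlRegularity.Negative

end
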